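import Summits.CriticalPhenomena.PercolationContinuityZ3.Theorems.PercNearOneGluingNoHeavyLowerTailMajorityGluingTypeTable
import Summits.CriticalPhenomena.PercolationContinuityZ3.Theorems.PercNearOneGluingNoHeavyLowerTailMajorityGluingTypeTableClasses
import HarnessLib

/-!
# Relabelling the relays `2, 3, 4` on the 94-type table: the `S₃`-symmetry behind «4 order classes instead of 24»
(lane prim-rate, constants-miner 1, gen 28; CONVEX-BOOTSTRAP.md §5 «O-free rows ⇒ relays 2,3,4 exchangeable (symcheck.py)»; KERNEL-WINDOW.md §3 item 5)

Support file for the closed crux `NoHeavyLowerTail` (stmt-CriticalPhenomena-4575), majority-gluing line.  The fixed-`M` window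
programme (templates A/B, `…TypeTableFixedM*`) is certified per CASE = a total order of the layers `T_z` and a richness flag per
relay; the lane certifies only the 4 order classes «position of relay 1» because its `O`-free hypothesis set is invariant under
permutations of the relays `2, 3, 4`.  This file makes that symmetry a KERNEL fact about the table: for each of the six
permutations `σ` of `{2,3,4}` a computable `relabel σ : DType → DType` (table lookup of the type with transported block partition
and cut flags), the `decide`d facts that it maps the table bijectively onto itself (`relabel_perm`), and the reindexing
identity for laws, `lin φ (x ∘ relabel σ) = lin (φ ∘ relabel σ') x` for the inverse `σ'` (`lin_relabel`), together with the
typewise equivariance of the event functionals (`relabel_events`: `T, S, C, P, all-cut, cut, e, π, ρ, u`).  The transport of the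
programme's hypotheses and the case cover are assembled on top (with `…TypeTableFixedMIso`).  No sorries.
[cite: VandenbergHaggstromKahn2005, Thm. 1.3 (p. 6)]
-/

namespace Summit.CriticalPhenomena.PercolationContinuityZ3.Theorems

namespace HubOnly
namespace TypeTable

open DType

/-- The six permutations of `{2,3,4}` as image triples `(σ2, σ3, σ4)`. -/
def perms3 : List (ℕ × ℕ × ℕ) := [(2, 3, 4), (2, 4, 3), (3, 2, 4), (3, 4, 2), (4, 2, 3), (4, 3, 2)]

/-- The inverse permutation (as an image triple). -/
def invPerm : ℕ × ℕ × ℕ → ℕ × ℕ × ℕ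
  | (3, 4, 2) => (4, 2, 3)
  | (4, 2, 3) => (3, 4, 2)
  | σ => σ

/-- Apply a relabelling to a point of `{0,…,4}` (`0, 1` fixed). -/
def appP (σ : ℕ × ℕ × ℕ) (x : ℕ) : ℕ := if x = 2 then σ.1 else if x = 3 then σ.2.1 else if x = 4 then σ.2.2 else x

namespace DType

/-- `τ'` is the `σ`-image of `τ`: the block partition `π` and the cut flags transported along `σ` (the five-point
connectivity `conn`/`sep` is then transported too, `att = !cut`). -/
def isImage (σ : ℕ × ℕ × ℕ) (τ τ' : DType) : Bool :=
  [1, 2, 3, 4].all fun x => (τ'.cut (appP σ x) == τ.cut x) && [1, 2, 3, 4].all fun y => τ'.inBlk (appP σ x) (appP σ y) == τ.inBlk x y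

end DType

/-- The relabelled type (table lookup; identity off the table). -/
def relabel (σ : ℕ × ℕ × ℕ) (τ : DType) : DType := (allTypes.find? (DType.isImage σ τ)).getD τ

/-- `relabel σ` maps every type of the table to a type of the table which IS its `σ`-image, and `relabel (invPerm σ)` undoes it. -/
theorem relabel_table : ∀ σ ∈ perms3, ∀ τ ∈ allTypes,
    relabel σ τ ∈ allTypes ∧ DType.isImage σ τ (relabel σ τ) = true ∧ relabel (invPerm σ) (relabel σ τ) = τ := by
  decide +kernel

/-- `relabel σ` permutes the table. -/
theorem relabel_perm : ∀ σ ∈ perms3, (allTypes.map (relabel σ)).Perm allTypes := by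
  decide +kernel

/-- `invPerm σ` is again one of the six permutations. -/
theorem invPerm_mem : ∀ σ ∈ perms3, invPerm σ ∈ perms3 := by decide +kernel

/-! ### Reindexing of laws -/

section
open Classical in
/-- **Reindexing.**  For a law `x` and a permutation `σ`: `lin φ (x ∘ relabel σ') = lin (φ ∘ relabel σ) x` with `σ' = invPerm σ`
(substitute `τ = relabel σ τ₀` in the sum over the table, a bijection). -/
theorem lin_relabel (σ : ℕ × ℕ × ℕ) (hσ : σ ∈ perms3) (φ : DType → ℤ) (x : DType → ℝ) :
    lin φ (fun τ => x (relabel (invPerm σ) τ)) = lin (fun τ => φ (relabel σ τ)) x := by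
  unfold lin
  have hp := relabel_perm σ hσ
  -- rewrite the right-hand sum along the permutation `allTypes.map (relabel σ) ~ allTypes`
  have e : (allTypes.map fun τ => ((φ (relabel σ τ) : ℤ) : ℝ) * x τ) =
      ((allTypes.map (relabel σ)).map fun τ' => (φ τ' : ℝ) * x (relabel (invPerm σ) τ')) := by
    rw [List.map_map]
    apply List.map_congr_left
    intro τ hτ
    simp only [Function.comp]
    rw [(relabel_table σ hσ τ hτ).2.2]
  rw [e]
  exact (List.Perm.sum_eq (hp.map _)).symm

end

/-! ### Equivariance of the event functionals (typewise, by `decide`) -/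

/-- Transport of the basic events along `relabel σ`: for `τ' = relabel σ τ`, `cut`, `T_z`, `S_z`, `C_{wv}`, `P_{wv}`, all-cut, `e`,
`π_{z¬y}` at the IMAGE indices equal the originals. -/
theorem relabel_events : ∀ σ ∈ perms3, ∀ τ ∈ allTypes,
    (∀ z ∈ [1, 2, 3, 4], (relabel σ τ).cut (appP σ z) = τ.cut z ∧ (relabel σ τ).isT (appP σ z) = τ.isT z ∧
      (relabel σ τ).isS (appP σ z) = τ.isS z ∧
      (∀ y ∈ [1, 2, 3, 4], (relabel σ τ).isC (appP σ z) (appP σ y) = τ.isC z y ∧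
        (relabel σ τ).isP (appP σ z) (appP σ y) = τ.isP z y ∧ (relabel σ τ).piSupp (appP σ z) (appP σ y) = τ.piSupp z y)) ∧
    (relabel σ τ).allCut = τ.allCut ∧ (relabel σ τ).eZ = τ.eZ ∧ (relabel σ τ).cutZ 1 = τ.cutZ 1 := by
  decide +kernel

/-- Transport of the isolation and support indicators of the hub triples, relay triples, the relay 4-set, the hub 4-sets and
the 5-set (as unordered sets: the image list is re-sorted by membership). -/
theorem relabel_iso : ∀ σ ∈ perms3, ∀ τ ∈ allTypes,
    (∀ S ∈ [[0, 1, 2], [0, 1, 3], [0, 1, 4], [0, 2, 3], [0, 2, 4], [0, 3, 4], [1, 2, 3], [1, 2, 4], [1, 3, 4], [2, 3, 4],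
        [1, 2, 3, 4], [0, 1, 2, 3], [0, 1, 2, 4], [0, 1, 3, 4], [0, 2, 3, 4], [0, 1, 2, 3, 4]],
      ∀ S' ∈ [[0, 1, 2], [0, 1, 3], [0, 1, 4], [0, 2, 3], [0, 2, 4], [0, 3, 4], [1, 2, 3], [1, 2, 4], [1, 3, 4], [2, 3, 4],
        [1, 2, 3, 4], [0, 1, 2, 3], [0, 1, 2, 4], [0, 1, 3, 4], [0, 2, 3, 4], [0, 1, 2, 3, 4]],
      (S'.all fun s' => S.any fun s => appP σ s == s') = true → S.length = S'.length →
        (relabel σ τ).uB S' = τ.uB S ∧ ∀ s ∈ S, (relabel σ τ).rho S' (appP σ s) = τ.rho S s) := by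
  decide +kernel

end TypeTable
end HubOnly

end Summit.CriticalPhenomena.PercolationContinuityZ3.Theorems
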